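import Literature.AlgebraicGeometry.HodgeTheory.ComplexTorusIntegralHodgeClassesKunnethProjectorsDegree
import Literature.AlgebraicGeometry.HodgeTheory.ComplexTorusIntegralHodgeClassesCorrespondenceFunctoriality
import HarnessLib

/-!
# The Künneth projectors `π_s ∈ Hdgᵍ(X × X, ℤ)`: independence of the frames and non-vanishing

API riders for g29-#5 (`ComplexTorusIntegralHodgeClassesKunnethProjectors`, `π_s = K_s[Δ_X]` formed in lattice frames `eX : Fin 2g ≃ ι_X`, `e : Fin 4g ≃ ι_X ⊔ ι_X`)
and g29-#12 (`deg(π_a · [Δ_X]) = (−1)ᵈ C(2g, d)`):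

* **`kunnethProjector_eq_of_enum`** — `π_s` does not depend on the frames (`[Δ_X] = (1,1)_* 1_X` is frame-free, `integralHodgeClassesPushforward_eq_of_enum'`);
* **`kunnethProjector_ne_zero`** — `π_s ≠ 0` for `0 ≤ s ≤ 2g` (Lange (6.16)/(6.14): every Künneth piece `Hˢ(X) ⊗ H^{2g−s}(X)` of `[Δ]` is hit; here from
  `deg(π_s · [Δ_X]) = ± C(2g, 2g−s) ≠ 0`), complementing `kunnethProjector_eq_zero_of_lt` (`π_s = 0` for `s > 2g`).

## References
* [Lange2023AbelianVarietiesComplex] H. Lange, Abelian Varieties over the Complex Numbers, Springer 2023, §6.3.4 (p0317 L28–L32), §6.3.3 (6.14)–(6.16), §1.1.4 Prop. 1.1.20.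
* [Fulton1998] W. Fulton, Intersection Theory, 2nd ed., Springer 1998, §16.1 Example 16.1.15 (p0302 L36–L40).
-/

noncomputable section

open CategoryTheory Function

namespace Literature.AlgebraicGeometry.HodgeTheory

open Literature.AlgebraicGeometry.Motives Literature.AlgebraicGeometry.Motives.HodgeStructure
open Literature.Geometry.Kaehler Literature.Geometry.Kaehler.ComplexTorus

namespace ComplexTorusCat

section Frames

variable (X : ComplexTorusCat) {g₁ g : ℕ} (hgg : g₁ + g₁ = g) (eX eX' : Fin (2 * g₁) ≃ X.toIsog.ι) (e e' : Fin (2 * g) ≃ (prodObj X X).toIsog.ι)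
  (hX : 2 * g₁ + 2 * 0 = 2 * g₁) (hg₁ : g₁ + g₁ = 2 * g₁) (hc : 2 * g₁ + 2 * g₁ = 2 * g) (hg' : g + g = 2 * g)

/-- **The Künneth projectors do not depend on the lattice frames**: `π_s` formed with `(eX, e)` equals `π_s` formed with `(eX′, e′)` — `[Δ_X] = (1_X, 1_X)_* 1_X` is
independent of the frames (g27 `integralHodgeClassesPushforward_eq_of_enum'`) and `K_s` is intrinsic. [cite: Lange2023AbelianVarietiesComplex, §6.3.4 (p0317 L28–L32)]
[cite: Fulton1998, §16.1 Cor. 16.1.1 (p0295 L7)] -/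
theorem kunnethProjector_eq_of_enum (s : ℕ) : kunnethProjector X eX e hX hg₁ hc hg' s = kunnethProjector X eX' e' hX hg₁ hc hg' s :=
  Subtype.ext (by
    rw [coe_kunnethProjector, coe_kunnethProjector, integralHodgeClassesPushforward_eq_of_enum' 0 g₁ (diagHom X) rfl rfl eX eX' e e' hX hg₁ hc hg' hX hg₁ hc hg'])

include hgg in
/-- **`π_s ≠ 0` for `s ≤ 2g`** (`g = dim X`): the Künneth component of the diagonal in `H^{2g−s}(X) ⊗ Hˢ(X)` is non-zero, since `deg(π_s · [Δ_X]) = (−1)ᵈ C(2g, d) ≠ 0`,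
`d = 2g − s` (g29-#12; `b_d(X) = C(2g, d) > 0`). With `kunnethProjector_eq_zero_of_lt`: `π_s ≠ 0 ↔ s ≤ 2g`. [cite: Lange2023AbelianVarietiesComplex, §6.3.4 (p0317 L28–L32) and
§6.3.3 (6.14), (6.16)] [cite: Fulton1998, §16.1 Example 16.1.15 (p0302 L36–L40)] -/
theorem kunnethProjector_ne_zero {s : ℕ} (hs : s ≤ 2 * g₁) : kunnethProjector X eX e hX hg₁ hc hg' s ≠ 0 := by
  intro h0
  obtain ⟨d, hd⟩ : ∃ d : ℕ, 2 * g₁ = d + s := ⟨2 * g₁ - s, by omega⟩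
  have h := integralHodgeClassesDeg_kunnethProjector_cup_diagonalClass X hgg eX e hX hg₁ hc hg' hd
  rw [h0, map_zero, AddMonoidHom.zero_apply, map_zero] at h
  have hu : (-1 : ℤ) ^ d * (-1 : ℤ) ^ d = 1 := by rw [← pow_add, ← two_mul, pow_mul, neg_one_sq, one_pow]
  have hC : ((2 * g₁).choose d : ℤ) = 0 := by
    calc ((2 * g₁).choose d : ℤ) = (-1 : ℤ) ^ d * ((-1 : ℤ) ^ d * ((2 * g₁).choose d : ℤ)) := by rw [← mul_assoc, hu, one_mul]
      _ = 0 := by rw [← h, mul_zero]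
  exact (Nat.choose_pos (by omega : d ≤ 2 * g₁)).ne' (by exact_mod_cast hC)

include hgg in
/-- **`π_s ≠ 0 ↔ s ≤ 2g`.** [cite: Lange2023AbelianVarietiesComplex, §6.3.4 (p0317 L28–L32)] -/
theorem kunnethProjector_ne_zero_iff (s : ℕ) : kunnethProjector X eX e hX hg₁ hc hg' s ≠ 0 ↔ s ≤ 2 * g₁ :=
  ⟨fun h ↦ not_lt.1 fun hs ↦ h (kunnethProjector_eq_zero_of_lt X eX e hX hg₁ hc hg' hs), kunnethProjector_ne_zero X hgg eX e hX hg₁ hc hg'⟩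

end Frames

end ComplexTorusCat

end Literature.AlgebraicGeometry.HodgeTheory
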